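import Mathlib
import Literature.Computability.Complexity.SymmetricWeisfeilerLemanSymmetry
import Literature.Computability.Complexity.SymmetricWeisfeilerLemanSemantics
import Summits.PneNP.PneNP.Theorems.SymmetryBudgetWindowBarrierMonadicGuess
import Summits.PneNP.PneNP.Theorems.SymmetryBudgetWindowBarrierTwinIsoCapstone

/-!
# `Tame₂ → ¬ HardToIdentify`: the identification dichotomy behind crux `SymmetryBudget.WindowBarrier`
# (item stmt-PneNP-2145, line `bijection-gauge-twin-iso`; dually item stmt-PneNP-14781 `NoHiddenOrder`)

The line's capstone (`windowBarrier_of_hardToIdentify`, landed) reads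
`babaiLuks1983_canonicalForm → HardToIdentify → WindowBarrier`, where the OPEN core is

  `HardToIdentify (HTI)`: for every `c`, for infinitely many `h`, some graph `H` on `h` vertices
  has NO `Sym(h)`-symmetric threshold circuit of size `≤ 2^{c h}` deciding `x ↦ [Gr x ≅ H]`.

This file proves, sorry-free and from landed tools only, that HTI is FALSE as soon as the following
purely combinatorial statement holds for one constant `c₀` ("every graph is identified, after
marking ONE vertex subset, by `(c₀ h / log₂ h)`-dimensional Weisfeiler–Leman among marked graphs"):

  `Tame₂ c₀`: for all large `h` and every `H` on `Fin h` there is `S ⊆ Fin h` such that every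
  marked graph `(G, T)` on `Fin h` that is `k`-WL-equivalent to `(H, S)` as a 2-coloured graph,
  `k = c₀ h / ⌊log₂ h⌋` (`WLEquivC`, `Literature/ModelTheory/FiniteModelTheory/WeisfeilerLemanColoured`),
  has `G ≅ H`.

* `hasSymCircuit_exists_wlEquivC` (the TOOL, unconditional): for every target `(H, d)` and every
  `k`, the function `x ↦ [∃ T ⊆ Fin h, (Gr x, T) ≡_{k-WL} (H, d)]` has a `Sym(h)`-symmetric
  threshold circuit of size `2^h · 17 (h^{2k}+1)(h^k+1)²(h+1)² + 3`: the symmetric `k`-WL matching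
  circuit of `Literature/Computability/Complexity/SymmetricWeisfeilerLeman*.lean` (gates
  `M(t, ū, ī) = [C_t(x,T; ū) = C_t(H,d; ī)]` by the refinement recurrence with exact counts by
  padded majorities; symmetric because `Sym(h)` only renames the x-side indices; correct at the
  explicit stable round `T = h^k · h^k`), fed to the MATERIALISATION of monadic guesses
  (`stub_monadicGuess`, landed p129358: an `(σ×σ)⊕σ`-symmetric circuit on `(Fin h × Fin h) ⊕ Fin h`
  becomes a square-symmetric circuit computing `∃ S, C(x, 1_S)` at cost `2^h · |C| + 3`).
* `hasSymCircuit_isoTo_of_tame2`: under `Tame₂ c₀` the same circuit computes `x ↦ [Gr x ≅ H]`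
  (soundness is `Tame₂`; completeness is invariance of coloured WL under the isomorphism, with the
  marking pulled back), and its size is `≤ 2^{(8 c₀ + 13) h}` for large `h`
  (`size_le_two_pow_of_le`: `h^k ≤ 2^{(⌊log₂ h⌋+1) k} ≤ 2^{2 c₀ h}`).
* `hardToIdentify_false_of_tame2`: hence `Tame₂ c₀ → ¬ HTI` (HTI spelled exactly as the hypothesis of
  `windowBarrier_of_hardToIdentify`; the closing `example` type-checks the match).

Consequences for the crux pair. The line `bijection-gauge-twin-iso` for `WindowBarrier` is DEAD
under `Tame₂` (its stub `stub_hardToIdentify` is refuted modulo `Tame₂`), independently of the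
Babai–Luks debt; a witness family for HTI must violate `Tame₂` for every `c₀`, i.e. consist of graphs
whose `(c h/log h)`-WL identification is not restored by ANY single marking — no such family is on
file (CFI/multipede/group-CSP families are identified by 3-WL after one marking; TECH-AND-GAP.md on
the item). `Tame₂` itself is open; it is the precise combinatorial content of "no hidden order in the
window" on the decision side (the canonisation side, which would give `NoHiddenOrder` through the
landed pad `noHiddenOrder_of_graphCanonisation`, is stronger).

Nothing here is a new definition: `Tame₂` is an explicit hypothesis, the target data of the circuit
are built with the anonymous constructor of `SymWL.Target`.
-/

set_option linter.dupNamespace false -- `Summit.PneNP.PneNP.…`: summit = sub-problem name (D-0017 single-conjunct layout)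

namespace Summit.PneNP.PneNP.Theorems

open Literature.Computability.Complexity Literature.ModelTheory.FiniteModelTheory Filter Finset
open scoped Classical

/-! ### The tool: `∃ T, (Gr x, T) ≡_{k-WL} (H, d)` is symmetric-cheap -/

/-- **Symmetric circuits for "some marking of the input is `k`-WL-equivalent to the marked target".**
For every `h k`, every target graph `H` on `Fin h` and marking `d`, the function
`x ↦ [∃ T ⊆ Fin h, WLEquivC k (Gr x, 1_T) (H, d)]` on `h × h` Boolean matrices has a
`Sym(h)`-symmetric `tcBasis` circuit of size `≤ 2^h · (17 · (h^k·h^k+1) · (h^k+1)² · (h+1)²) + 3`: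
the symmetric `k`-WL matching circuit against `(H, d)` with `T = h^k · h^k` rounds (Literature
`SymWL.wlDAG`, evaluated by `SymWL.compile_wlDAG_eval_iff_wlEquivC`, symmetric by
`SymWL.compile_wlDAG_isInducedAut`, of size `SymWL.compile_wlDAG_size_le`), materialised over the
`2^h` markings by `stub_monadicGuess`. -/
theorem hasSymCircuit_exists_wlEquivC (h k : ℕ) (H : SimpleGraph (Fin h)) (d : Fin h → Bool) :
    HasSymCircuit tcBasis Set.univ
      (2 ^ h * (17 * ((h ^ k * h ^ k + 1) * ((h ^ k + 1) * (h ^ k + 1)) * ((h + 1) * (h + 1)))) + 3)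
      (fun x : Fin h × Fin h → Bool => decide (∃ Tm : Finset (Fin h),
        WLEquivC k (SimpleGraph.fromRel fun u v => x (u, v) = true) (fun u => decide (u ∈ Tm)) H d)) := by
  let tgt : SymWL.Target h k (h ^ k * h ^ k) :=
    ⟨fun i j => decide (H.Adj i j), d,
     fun t ī w' => (univ.filter fun w'' : Fin h =>
        (atpC H d (Fin.snoc ī w'' : Fin (k + 1) → Fin h),
          fun j => wlColourC H d (t : ℕ) (Function.update ī j w'')) =
        (atpC H d (Fin.snoc ī w' : Fin (k + 1) → Fin h),
          fun j => wlColourC H d (t : ℕ) (Function.update ī j w'))).card,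
     fun ī => (univ.filter fun ā : Fin k → Fin h =>
        wlColourC H d (h ^ k * h ^ k) ā = wlColourC H d (h ^ k * h ^ k) ī).card⟩
  obtain ⟨D, hDB, hDsize, hDsym, hDeval⟩ := stub_monadicGuess h (SymWL.wlDAG tgt).compile
    (SymWL.compile_wlDAG_isOver tgt) (SymWL.compile_wlDAG_isInducedAut tgt)
  refine ⟨D, hDB, ?_, hDsym, fun x => ?_⟩
  · rw [hDsize]
    exact Nat.add_le_add_right (Nat.mul_le_mul_left _ (SymWL.compile_wlDAG_size_le tgt)) 3
  · rw [hDeval x]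
    refine decide_eq_decide.mpr (exists_congr fun Tm => ?_)
    exact SymWL.compile_wlDAG_eval_iff_wlEquivC tgt (Sum.elim x fun u => decide (u ∈ Tm)) H d
      (fun _ _ => rfl) (fun _ => rfl) (fun _ _ _ => rfl) (fun _ => rfl) le_rfl

/-! ### Size arithmetic -/

/-- `h^k ≤ 2^{2 c₀ h}` for `k = c₀ h / ⌊log₂ h⌋` and `h ≥ 2` (`h < 2^{⌊log₂ h⌋+1}` and
`(⌊log₂ h⌋ + 1) · k ≤ 2 c₀ h`). [folklore] -/
theorem pow_div_log_le (c₀ h : ℕ) (hh : 2 ≤ h) :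
    h ^ (c₀ * h / Nat.log 2 h) ≤ 2 ^ (2 * c₀ * h) := by
  set L := Nat.log 2 h with hL
  set k := c₀ * h / L with hk
  have hL1 : 1 ≤ L := Nat.log_pos (by norm_num) hh
  have hlt : h < 2 ^ (L + 1) := Nat.lt_pow_succ_log_self (by norm_num) h
  have hkL : k * L ≤ c₀ * h := Nat.div_mul_le_self _ _
  have hk' : k ≤ c₀ * h := by
    calc k = k * 1 := (Nat.mul_one k).symm
      _ ≤ k * L := Nat.mul_le_mul_left k hL1
      _ ≤ c₀ * h := hkL
  calc h ^ k ≤ (2 ^ (L + 1)) ^ k := Nat.pow_le_pow_left hlt.le k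
    _ = 2 ^ ((L + 1) * k) := by rw [← pow_mul]
    _ ≤ 2 ^ (2 * c₀ * h) := Nat.pow_le_pow_right (by norm_num) (by nlinarith)

/-- The size of the materialised matching circuit is `≤ 2^{(8 c₀ + 13) h}` once `h^k ≤ 2^{2 c₀ h}`
and `h ≥ 1`. [folklore] -/
theorem size_le_two_pow_of_le {c₀ h p : ℕ} (hh : 1 ≤ h) (hp : p ≤ 2 ^ (2 * c₀ * h)) :
    2 ^ h * (17 * ((p * p + 1) * ((p + 1) * (p + 1)) * ((h + 1) * (h + 1)))) + 3 ≤
      2 ^ ((8 * c₀ + 13) * h) := by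
  set a := 2 * c₀ * h with ha
  have hA1 : 1 ≤ 2 ^ a := Nat.one_le_two_pow
  have h1 : p * p + 1 ≤ 2 ^ (2 * a + 1) := by
    calc p * p + 1 ≤ 2 ^ a * 2 ^ a + 2 ^ a * 2 ^ a :=
          Nat.add_le_add (Nat.mul_le_mul hp hp) (Nat.mul_le_mul hA1 hA1)
      _ = 2 ^ (2 * a + 1) := by ring
  have h2 : (p + 1) * (p + 1) ≤ 2 ^ (2 * a + 2) := by
    calc (p + 1) * (p + 1) ≤ (2 ^ a + 2 ^ a) * (2 ^ a + 2 ^ a) :=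
          Nat.mul_le_mul (Nat.add_le_add hp hA1) (Nat.add_le_add hp hA1)
      _ = 2 ^ (2 * a + 2) := by ring
  have h3 : (h + 1) * (h + 1) ≤ 2 ^ h * 2 ^ h := by
    have := Nat.lt_two_pow_self (n := h)
    exact Nat.mul_le_mul this this
  have h4 : 17 * ((p * p + 1) * ((p + 1) * (p + 1)) * ((h + 1) * (h + 1))) ≤ 2 ^ (4 * a + 2 * h + 8) := by
    calc 17 * ((p * p + 1) * ((p + 1) * (p + 1)) * ((h + 1) * (h + 1)))
        ≤ 2 ^ 5 * (2 ^ (2 * a + 1) * 2 ^ (2 * a + 2) * (2 ^ h * 2 ^ h)) := by gcongr; norm_num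
      _ = 2 ^ (4 * a + 2 * h + 8) := by ring
  calc 2 ^ h * (17 * ((p * p + 1) * ((p + 1) * (p + 1)) * ((h + 1) * (h + 1)))) + 3
      ≤ 2 ^ h * 2 ^ (4 * a + 2 * h + 8) + 3 * (2 ^ h * 2 ^ (4 * a + 2 * h + 8)) := by
        gcongr
        exact Nat.le_mul_of_pos_right 3 (by positivity)
    _ = 2 ^ (4 * a + 3 * h + 10) := by ring
    _ ≤ 2 ^ ((8 * c₀ + 13) * h) := Nat.pow_le_pow_right (by norm_num) (by rw [ha]; nlinarith)

/-! ### The bridge -/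

/-- **Under `Tame₂ c₀`, isomorphism to every fixed graph is symmetric-cheap at scale `2^{O(h)}`.**
If for all large `h` every graph `H` on `Fin h` admits a marking `S` such that every marked graph
`(G, T)` on `Fin h` with `(G, 1_T) ≡_{k-WL} (H, 1_S)`, `k = c₀ h / ⌊log₂ h⌋`, is isomorphic to `H`, then
for all large `h` and every `H` on `Fin h`, the function `x ↦ [Gr x ≅ H]` has a `Sym(h)`-symmetric
threshold circuit of size `≤ 2^{(8 c₀ + 13) h}`: the circuit of
`hasSymCircuit_exists_wlEquivC` for the target `(H, 1_S)` computes it — if it accepts, `Tame₂` gives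
the isomorphism; if `e : Gr x ≅ H`, the pulled-back marking `T = e⁻¹ S` makes the two marked graphs
isomorphic, hence WL-equivalent (`WLEquivC.of_iso`). -/
theorem hasSymCircuit_isoTo_of_tame2 (c₀ : ℕ)
    (htame : ∀ᶠ h in atTop, ∀ H : SimpleGraph (Fin h), ∃ S : Finset (Fin h),
      ∀ (G : SimpleGraph (Fin h)) (Tm : Finset (Fin h)),
        WLEquivC (c₀ * h / Nat.log 2 h) G (fun u => decide (u ∈ Tm)) H (fun u => decide (u ∈ S)) →
          Nonempty (G ≃g H)) :
    ∀ᶠ h in atTop, ∀ H : SimpleGraph (Fin h),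
      HasSymCircuit tcBasis Set.univ (2 ^ ((8 * c₀ + 13) * h))
        (fun x : Fin h × Fin h → Bool =>
          decide (Nonempty ((SimpleGraph.fromRel fun u v => x (u, v) = true) ≃g H))) := by
  filter_upwards [htame, eventually_ge_atTop 2] with h hh h2 H
  obtain ⟨S, hS⟩ := hh H
  have hcirc := hasSymCircuit_exists_wlEquivC h (c₀ * h / Nat.log 2 h) H (fun u => decide (u ∈ S))
  have hfun : (fun x : Fin h × Fin h → Bool => decide (∃ Tm : Finset (Fin h),
      WLEquivC (c₀ * h / Nat.log 2 h) (SimpleGraph.fromRel fun u v => x (u, v) = true)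
        (fun u => decide (u ∈ Tm)) H (fun u => decide (u ∈ S)))) =
      fun x => decide (Nonempty ((SimpleGraph.fromRel fun u v => x (u, v) = true) ≃g H)) := by
    funext x
    refine decide_eq_decide.mpr ⟨fun ⟨Tm, hW⟩ => hS _ Tm (by convert hW), fun ⟨e⟩ => ?_⟩
    refine ⟨univ.filter fun u => e u ∈ S, WLEquivC.of_iso e fun u => ?_⟩
    simp
  rw [hfun] at hcirc
  exact hcirc.mono (size_le_two_pow_of_le (by omega) (pow_div_log_le c₀ h h2))

/-- **`Tame₂ c₀ → ¬ HardToIdentify`.** With HTI spelled exactly as the hypothesis of the landed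
capstone `windowBarrier_of_hardToIdentify` (stub `stub_hardToIdentify` of the line
`bijection-gauge-twin-iso`): a tame constant `c₀` gives `c = 8 c₀ + 13` at which iso-to-`H` is
eventually symmetric-cheap for EVERY `H`, contradicting "frequently some `H` is hard at `c`". -/
theorem hardToIdentify_false_of_tame2 : ∀ c₀ : ℕ, (∀ᶠ h in atTop, ∀ H : SimpleGraph (Fin h),
    ∃ S : Finset (Fin h), ∀ (G : SimpleGraph (Fin h)) (Tm : Finset (Fin h)),
      WLEquivC (c₀ * h / Nat.log 2 h) G (fun u => decide (u ∈ Tm)) H (fun u => decide (u ∈ S)) →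
        Nonempty (G ≃g H)) →
    ¬ (∀ c : ℕ, ∃ᶠ h in atTop, ∃ H : SimpleGraph (Fin h),
      ¬ HasSymCircuit tcBasis Set.univ (2 ^ (c * h))
        (fun x : Fin h × Fin h → Bool =>
          decide (Nonempty ((SimpleGraph.fromRel fun u v => x (u, v) = true) ≃g H)))) := by
  intro c₀ htame hHTI
  obtain ⟨h, ⟨H, hH⟩, hall⟩ :=
    ((hHTI (8 * c₀ + 13)).and_eventually (hasSymCircuit_isoTo_of_tame2 c₀ htame)).exists
  exact hH (hall H)

/-- Sanity check (not a new result): the refuted statement is literally the `HardToIdentify`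
hypothesis of the landed capstone `windowBarrier_of_hardToIdentify`. -/
example (hBL : babaiLuks1983_canonicalForm)
    (hHTI : ∀ c : ℕ, ∃ᶠ h in atTop, ∃ H : SimpleGraph (Fin h),
      ¬ HasSymCircuit tcBasis Set.univ (2 ^ (c * h))
        (fun x : Fin h × Fin h → Bool =>
          decide (Nonempty ((SimpleGraph.fromRel fun u v => x (u, v) = true) ≃g H)))) :
    Summit.PneNP.PneNP.Theses.SymmetryBudget.WindowBarrier :=
  windowBarrier_of_hardToIdentify hBL hHTI

end Summit.PneNP.PneNP.Theorems
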